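import Summits.ABC.IUTFork.Joshi.RosettaFragment1
import Summits.ABC.IUTFork.Joshi.RosettaFragment3
import Mathlib.Analysis.Normed.Unbundled.SpectralNorm

/-!
# [J-III] §8.5 Rosetta Stone Fragment 3 over the Fragment-1 carrier: `StripDatum` from E-t16's `LocalHolDatum`
# (merge-debt reconciliation T-16 ↔ T-17) — TYPED, no side taken

abc-iut cell, branch E (rung LADDER-ABC:A2.E), seat abc-iut-E-t17. K. Joshi, arXiv 2401.13508 **v4** (bib `Joshi2024ATS3`,
UNREFEREED, rejected by the IUT author [Mochizuki2024JoshiReport]; typed AS A CANDIDATE, D-0012; typed ≠ proved ≠ endorsed;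
nothing asserts abc or [IUTchIII] Cor. 3.12). Render `HOME/lit/renders/Joshi-arxiv-2401.13508/pNNNN.txt`.

`Joshi/RosettaFragment3.lean` (p428939) typed Fragment 3 (§8.5, p.81–82) over an ABSTRACT signature `StripDatum Pi G Lbar Kv`
(interim carrier rule). `Joshi/RosettaFragment1.lean` (E-t16, p429272) fixed the CONCRETE Fragment-1 carrier: E-t1's untilt
`U : Untilt p` (`K_v := U.K`, a complete algebraically closed non-archimedean normed field), the preferred algebraic closure
`L̄_{v;K_v} := algebraicClosure L_v K_v` (`Rosetta.PrefAlgClosure`), `G_{L_v;K_v} := L̄_{v;K_v} ≃ₐ[L_v] L̄_{v;K_v}`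
(`Rosetta.PrefGal`) and the holomorphoid datum `Rosetta.LocalHolDatum Lv U Γ` (`aug : Γ = Π^temp_{X/L_v;K_v} ↠ G_{L_v;K_v}`,
[J-III] Thm. 2.4.1 (2)(a), Prop. 8.3.1.1). THIS FILE discharges the merge-debt recorded in both module docstrings: it BUILDS
the Fragment-3 signature from the Fragment-1 datum plus exactly the supplementary data §8.5–§8.6 read that §8.3 does not
(`TateSupplement`: the Tate quasi-period `q_{(X/L_v,X/K_v)} ∈ L_v` with `0 < ‖q‖ < 1`, p.83 l.45 – p.84 l.2; the prime `ℓ` of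
§3.3; and the invariance of `‖−‖_{K_{y_v}}` on `L̄_{v;K_v}` under `G_{L_v;K_v}` — the classical uniqueness of the extension of
the valuation of the complete field `L_v`, kept as a FIELD as in `StripDatum.abs_gal`), so that every Fragment-3 row of
`RosettaFragment3.lean` (`stripHol`, `stripTimes`, `stripTimesMu` (8.6.3), `stripTriTimesMu` (8.6.5), `stripPerp`,
realified strips (8.6.1.1)) is available ON THE SAME CARRIER as Fragment 1's étale-like / Frobenius-like rows
(`LocalHolDatum.etaleLike`, `.frobeniusLike`). PROVED: the projection `Π ↠ G` of the bridged datum IS Fragment 1's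
augmentation, its Galois action IS the tautological action of `Gal(L̄_{v;K_v}/L_v)`, and its `q` has the prescribed norm.
NOT proved here (recorded): the norm-cut `O^▷ = {x ≠ 0, ‖x‖ ≤ 1}` of Fragment 3 versus the integral-closure monoid
`Literature.AnabelianGeometry.AbsoluteAnabelian.nonzeroIntegers L_v L̄_{v;K_v}` of Fragment 1's `TM`-pair — their equality
is the classical «integral over `𝒪_{L_v}` ⟺ norm ≤ 1» for the complete discretely valued `L_v`, extending E-t16's field
`LocalHolDatum.norm_algebraMap_le_one_iff` from `L_v` to `L̄_v`; it is stated as the named `Prop` `OTriEqNonzeroIntegers`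
(OUR reading, untagged dictionary row, never asserted). [claim: Joshi2024ATS3, status: disputed]
-/

noncomputable section

namespace Summit.ABC.IUTFork.Joshi.ATS3

open Literature.IUT.HodgeArakelov Summit.ABC.IUTFork.Joshi.Rosetta
open Literature.AnabelianGeometry.AbsoluteAnabelian (nonzeroIntegers)

/-! ## 1. Generic pieces: the norm as an absolute value; the Galois group acting by ring automorphisms -/

/-- The norm of a normed field as a real absolute value (`|−|_{K_{y_v}} : K_{y_v} → ℝ`, [J-III] §8.6.1 p.84 l.5–9).
[folklore] -/
def normAbs (K : Type) [NormedField K] : AbsoluteValue K ℝ where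
  toFun := fun x => ‖x‖
  map_mul' := norm_mul
  nonneg' := fun x => norm_nonneg x
  eq_zero' := fun _ => norm_eq_zero
  add_le' := norm_add_le

/-- `normAbs` is the norm. [folklore] -/
@[simp] theorem normAbs_apply (K : Type) [NormedField K] (x : K) : normAbs K x = ‖x‖ := rfl

/-- `Gal(L/L_v) = L ≃ₐ[L_v] L` acting on `L` by ring automorphisms, as a group homomorphism to `RingAut L` (both groups
compose as `(σ * τ) x = σ (τ x)`). [folklore] -/
def galRingAut (Lv L : Type) [Field Lv] [Field L] [Algebra Lv L] : (L ≃ₐ[Lv] L) →* RingAut L where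
  toFun σ := σ.toRingEquiv
  map_one' := RingEquiv.ext fun _ => rfl
  map_mul' _ _ := RingEquiv.ext fun _ => rfl

/-- Value of `galRingAut`. [folklore] -/
@[simp] theorem galRingAut_apply (Lv L : Type) [Field Lv] [Field L] [Algebra Lv L] (σ : L ≃ₐ[Lv] L) (x : L) :
    galRingAut Lv L σ x = σ x := rfl

/-! ## 2. The supplement Fragment 3 reads beyond Fragment 1, and the bridged `StripDatum` -/

section Bridge

variable {p : ℕ} [Fact p.Prime] {Lv : Type} [Field Lv] [ValuativeRel Lv] {U : Untilt p} [Algebra Lv U.K]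
  {Γ : Type} [Group Γ] [TopologicalSpace Γ]

/-- **The data §8.5–§8.6 use beyond the holomorphoid datum of §8.3** ([J-III] p.83 l.45 – p.84 l.2: «`q_{(Y/E′,Y/K)}` is
the Tate quasi-period of the projective Tate elliptic curve `C/L_v` underlying `X/L_v` (with the period being computed in
the analytic space `C^an_{K_v}`)», an element of `L_v` of norm in `(0,1)`; the prime `ℓ` of the initial theta data §3.3
for the row `F^{⊢⊥} = G_v ↷ O^{μ_{2ℓ}} × q^ℕ`, p.82 l.45–50; and the `G_{L_v;K_v}`-invariance of `‖−‖_{K_v}` on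
`L̄_{v;K_v}`, the classical uniqueness of the extended valuation — a FIELD, as `StripDatum.abs_gal`). HYPOTHESIS
structure; nothing asserted. [claim: Joshi2024ATS3, status: disputed] -/
structure TateSupplement (Lv : Type) [Field Lv] (U : Untilt p) [Algebra Lv U.K] where
  /-- the Tate quasi-period `q ∈ L_v` -/
  q : Lv
  /-- `0 < ‖q‖_{K_v}` -/
  norm_q_pos : 0 < ‖algebraMap Lv U.K q‖
  /-- `‖q‖_{K_v} < 1` (Tate curve) -/
  norm_q_lt_one : ‖algebraMap Lv U.K q‖ < 1
  /-- the prime `ℓ` of §3.3 -/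
  ell : ℕ
  /-- `‖σ x‖ = ‖x‖` for `σ ∈ G_{L_v;K_v}`, `x ∈ L̄_{v;K_v} ⊂ K_v` -/
  norm_gal : ∀ (σ : PrefGal Lv U.K) (x : PrefAlgClosure Lv U.K), ‖toKv Lv U.K (σ x)‖ = ‖toKv Lv U.K x‖

/-- **Fragment 3's signature from Fragment 1's carrier**: the `StripDatum` (of `RosettaFragment3.lean`) with
`Pi := Γ = Π^temp_{X/L_v;K_v}`, `G := G_{L_v;K_v} = Rosetta.PrefGal`, `Lbar := L̄_{v;K_v} = Rosetta.PrefAlgClosure`,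
`Kv := K_v = U.K`, whose projection is Fragment 1's augmentation `aug` ([J-III] Thm. 2.4.1 (2)(a); row `D ⊢ G_v` of
Fragment 3, p.82 l.12), whose Galois action is the tautological one of `Gal(L̄_{v;K_v}/L_v)` fixing `L_v` (p.83
l.26–27), whose valuation is `‖−‖_{K_v}` (§8.6.1 p.84 l.5–9), and whose `q`, `ℓ` come from the supplement.
[claim: Joshi2024ATS3, status: disputed] -/
def StripDatum.ofLocalHol (H : LocalHolDatum Lv U Γ) (τ : TateSupplement Lv U) :
    StripDatum Γ (PrefGal Lv U.K) (PrefAlgClosure Lv U.K) U.K where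
  proj := H.aug
  proj_surjective := H.aug_surjective
  emb := (toKv Lv U.K).toRingHom
  Lv := (algebraMap Lv (PrefAlgClosure Lv U.K)).fieldRange
  gal := galRingAut Lv (PrefAlgClosure Lv U.K)
  gal_fix σ x hx := by
    obtain ⟨a, rfl⟩ := RingHom.mem_fieldRange.mp hx
    simp
  absK := normAbs U.K
  abs_gal σ x := by simpa using τ.norm_gal σ x
  q := algebraMap Lv (PrefAlgClosure Lv U.K) τ.q
  q_mem := RingHom.mem_fieldRange.mpr ⟨τ.q, rfl⟩
  absK_q_pos := by simpa [toKv] using τ.norm_q_pos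
  absK_q_lt_one := by simpa [toKv] using τ.norm_q_lt_one
  ell := τ.ell

variable (H : LocalHolDatum Lv U Γ) (τ : TateSupplement Lv U)

/-- PROVED: the bridged projection `Π^temp ↠ G_{L_v;K_v}` IS Fragment 1's augmentation (`LocalHolDatum.aug`, i.e. the
`ε_k` of the tree's `ModelMLFGaloisData` = `H.etaleLike.aug`). [claim: Joshi2024ATS3, status: disputed] -/
theorem ofLocalHol_proj : (StripDatum.ofLocalHol H τ).proj = H.aug := rfl

/-- PROVED: the bridged Galois action is the tautological action of `Gal(L̄_{v;K_v}/L_v)`.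
[claim: Joshi2024ATS3, status: disputed] -/
theorem ofLocalHol_gal_apply (σ : PrefGal Lv U.K) (x : PrefAlgClosure Lv U.K) :
    (StripDatum.ofLocalHol H τ).gal σ x = σ x := rfl

/-- PROVED: the bridged valuation on `L̄_{v;K_v}` is the restriction of `‖−‖_{K_v}`.
[claim: Joshi2024ATS3, status: disputed] -/
theorem ofLocalHol_absL_apply (x : PrefAlgClosure Lv U.K) :
    (StripDatum.ofLocalHol H τ).absL x = ‖toKv Lv U.K x‖ := rfl

/-- PROVED: the bridged Tate parameter has the prescribed absolute value `‖q‖_{K_v}` ((8.6.1.1): «calculate the absolute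
value of the Tate parameter», p.84 l.37–38). [claim: Joshi2024ATS3, status: disputed] -/
theorem ofLocalHol_absTate : (StripDatum.ofLocalHol H τ).absTate = ‖algebraMap Lv U.K τ.q‖ := by
  simp [StripDatum.absTate, StripDatum.ofLocalHol, toKv]

/-- **Fragment 3, row `F^{⊢×μ}` (8.6.3), on the Fragment-1 carrier**: `G_{L_v;K_v} ↷ O^{×μ}_{L̄_{v;K_v}}`.
[claim: Joshi2024ATS3, status: disputed] -/
def LocalHolStripTimesMu : CoveringMonoid (PrefGal Lv U.K) :=
  ⟨UnitsModTorsion (StripDatum.ofLocalHol H τ).OTri, (StripDatum.ofLocalHol H τ).stripTimesMu⟩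

/-- **Fragment 3, row `F^{⊢▶×μ}` (8.6.5), on the Fragment-1 carrier**: `G_{L_v;K_v} ↷ O^{×μ}_{L̄_{v;K_v}} × q^ℕ` — the type
along which §8.8 glues. [claim: Joshi2024ATS3, status: disputed] -/
def LocalHolStripTriTimesMu : CoveringMonoid (PrefGal Lv U.K) := (StripDatum.ofLocalHol H τ).stripTriTimesMu

/-- **Fragment 3, row `F` on the Fragment-1 carrier**: `Π^temp_{X/L_v;K_v} ↷ O^▷_{L̄_{v;K_v}}` (norm-cut `O^▷`), next to
Fragment 1's Frobenius-like `TM`-pair `Π^temp ↷ 𝒪^⊳_{L̄_{v;K_v}}` (`LocalHolDatum.frobeniusLike H .TM`, integral-closure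
`𝒪^⊳`). [claim: Joshi2024ATS3, status: disputed] -/
def LocalHolStripHol : CoveringMonoid Γ := (StripDatum.ofLocalHol H τ).stripHol

/-- OUR READING (dictionary row, untagged, never asserted): the two typings of `O^▷_{L̄_v}` agree — Fragment 3's norm
cut `{x ≠ 0, ‖x‖_{K_v} ≤ 1}` (`StripDatum.OTri`) and Fragment 1's integral closure of `𝒪_{L_v}` minus `0`
(`Literature.AnabelianGeometry.AbsoluteAnabelian.nonzeroIntegers`). Classically true for the complete discretely valued
`L_v` («integral ⟺ ‖−‖ ≤ 1», extending `LocalHolDatum.norm_algebraMap_le_one_iff` to `L̄_v`); NOT proved here. -/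
def OTriEqNonzeroIntegers : Prop :=
  ((StripDatum.ofLocalHol H τ).OTri : Set (PrefAlgClosure Lv U.K)) =
    (nonzeroIntegers Lv (PrefAlgClosure Lv U.K) : Set (PrefAlgClosure Lv U.K))

end Bridge

/-! ## 3. DISCHARGE (appended): the Galois-invariance FIELD `TateSupplement.norm_gal` is a THEOREM whenever `L_v` is a
complete non-archimedean nontrivially normed field isometrically embedded in `K_v` — the classical uniqueness of the
extension of a complete valuation to an algebraic extension, via Mathlib's spectral norm (`spectralNorm_unique_field_norm_ext`,
`spectralNorm_eq_of_equiv`). This removes the only non-structural hypothesis of the bridge under the standard reading of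
«`L_v` = the completion of `L` at `v`» (p.81 l.27). -/

section NormGal

variable {p : ℕ} [Fact p.Prime] {Lv : Type} [NontriviallyNormedField Lv] (U : Untilt p) [Algebra Lv U.K]

/-- The restriction of `‖−‖_{K_v}` to the preferred algebraic closure `L̄_{v;K_v} ⊂ K_v`, as an absolute value
([J-III] §8.6.1 p.84 l.7–9: «hence a valuation `|−|_{L̄_v}` on the algebraic closure `L̄_v ⊂ K_{y_v}`»). [claim: Joshi2024ATS3, status: disputed] -/
def prefAbs : AbsoluteValue (PrefAlgClosure Lv U.K) ℝ where
  toFun x := ‖toKv Lv U.K x‖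
  map_mul' x y := by simp only [map_mul, norm_mul]
  nonneg' x := norm_nonneg _
  eq_zero' x := by
    rw [norm_eq_zero]
    exact map_eq_zero_iff _ (toKv Lv U.K).toRingHom.injective
  add_le' x y := by simpa only [map_add] using norm_add_le (toKv Lv U.K x) (toKv Lv U.K y)

/-- Value of `prefAbs`. [folklore] -/
@[simp] theorem prefAbs_apply (x : PrefAlgClosure Lv U.K) : prefAbs U x = ‖toKv Lv U.K x‖ := rfl

/-- If `L_v ↪ K_v` is isometric, `prefAbs` extends the norm of `L_v`. [folklore] -/
theorem prefAbs_extends (hiso : ∀ x : Lv, ‖algebraMap Lv U.K x‖ = ‖x‖) (x : Lv) :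
    prefAbs U (algebraMap Lv (PrefAlgClosure Lv U.K) x) = ‖x‖ := by
  rw [prefAbs_apply, AlgHom.commutes]
  exact hiso x

/-- **DISCHARGED**: for `L_v` complete, non-archimedean, nontrivially normed and isometrically embedded in `K_v`, every
`σ ∈ G_{L_v;K_v} = Gal(L̄_{v;K_v}/L_v)` preserves `‖−‖_{K_v}` on `L̄_{v;K_v}` (both `‖−‖` and `‖σ(−)‖` equal the spectral
norm). This is the content of the field `StripDatum.abs_gal` / `TateSupplement.norm_gal`. [folklore] -/
theorem norm_gal_of_complete [CompleteSpace Lv] [IsUltrametricDist Lv]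
    (hiso : ∀ x : Lv, ‖algebraMap Lv U.K x‖ = ‖x‖) (σ : PrefGal Lv U.K) (x : PrefAlgClosure Lv U.K) :
    ‖toKv Lv U.K (σ x)‖ = ‖toKv Lv U.K x‖ := by
  have h := spectralNorm_unique_field_norm_ext (K := Lv) (L := PrefAlgClosure Lv U.K) (f := prefAbs U)
    (prefAbs_extends U hiso)
  rw [← prefAbs_apply, ← prefAbs_apply, h (σ x), h x, ← spectralNorm_eq_of_equiv σ x]

end NormGal

section OfComplete

variable {p : ℕ} [Fact p.Prime] {Lv : Type} [NontriviallyNormedField Lv] [CompleteSpace Lv] [IsUltrametricDist Lv]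
  [ValuativeRel Lv] (U : Untilt p) [Algebra Lv U.K]

/-- **The supplement with its Galois-invariance PROVED**: over a complete non-archimedean `L_v` isometrically embedded
in `K_v`, the Fragment-3 supplement is just `(q, 0 < ‖q‖ < 1, ℓ)` — `norm_gal` is `norm_gal_of_complete`.
[claim: Joshi2024ATS3, status: disputed] -/
def TateSupplement.ofComplete (q : Lv) (hq₀ : 0 < ‖algebraMap Lv U.K q‖) (hq₁ : ‖algebraMap Lv U.K q‖ < 1) (ell : ℕ)
    (hiso : ∀ x : Lv, ‖algebraMap Lv U.K x‖ = ‖x‖) : TateSupplement Lv U :=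
  ⟨q, hq₀, hq₁, ell, norm_gal_of_complete U hiso⟩

/-- The bridged `StripDatum` over a complete `L_v` needs no valuation-invariance hypothesis.
[claim: Joshi2024ATS3, status: disputed] -/
def StripDatum.ofLocalHolComplete {Γ : Type} [Group Γ] [TopologicalSpace Γ] (H : LocalHolDatum Lv U Γ) (q : Lv)
    (hq₀ : 0 < ‖algebraMap Lv U.K q‖) (hq₁ : ‖algebraMap Lv U.K q‖ < 1) (ell : ℕ)
    (hiso : ∀ x : Lv, ‖algebraMap Lv U.K x‖ = ‖x‖) :
    StripDatum Γ (PrefGal Lv U.K) (PrefAlgClosure Lv U.K) U.K :=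
  StripDatum.ofLocalHol H (TateSupplement.ofComplete U q hq₀ hq₁ ell hiso)

end OfComplete

end Summit.ABC.IUTFork.Joshi.ATS3

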